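import Mathlib
import HarnessLib
import Literature.Computability.AlgebraicComplexity.PatternExpressions
import Literature.Combinatorics.SimpleGraph.TreeDecomposition
import Summits.ValiantsHypothesis.ValiantsHypothesis.Theorems.MonotoneRestorationMonotoneRestorationQPLinearWidthDefs
import Summits.ValiantsHypothesis.ValiantsHypothesis.Theorems.MonotoneRestorationMonotoneRestorationQPLinearWidthNarrowDetermined

/-!
# Route MonotoneRestoration, crux `MonotoneRestorationQP` (stmt-15886), line `linear-width` —
# (Q1) "DETERMINED ⇒ NARROW" HAS A FINITE REFUTATION FORMAT: THE CUSP TEST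

Helper file (`--supports stmt-ValiantsHypothesis-15886`), def-free.

(Q1) of `…LinearWidthDeterminedVsNarrow.lean` / `…LinearWidthQ1Bridge.lean` asks, at a level `n` and a width
`k`, whether every polynomial DETERMINED by `HomIndist n k` (equal values at points agreeing on all
`hom_{F,n}`, `tw F < k`) is NARROW (lies in the `ℂ`-span of the `hom_{F,n}`, `tw F ≤ k`).  A quantitative
(Q1) would, with the landed K2/K3 of line `narrow-expansion`, turn `WidthRestorationQP` (rung + GAP 1 of
line `linear-width`) into bookkeeping, and it identifies GAP 2 with K1 (`Q1Bridge`).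

ALGEBRA BEHIND THIS FILE (informal; not needed by the kernel).  The narrow span `N_k` is a graded
subalgebra of the invariant ring `S = ℂ[x]^{S_n × S_n}` (disjoint union of patterns = product), `S` is a
finite module over `N_k` once `k ≥ 2` (the power sums `Σ x_ij^m = hom` of an `m`-fold edge lie in `N_2`),
and the determined polynomials `D_k` are exactly the elements of `S` constant on the fibres of
`Spec S → Spec N_k`; over `ℂ` this makes `D_k` the WEAK NORMALISATION (= seminormalisation) of `N_k`
inside `S`, so (Q1) at `(n, k)` says "`N_k` is seminormal in `S`".  Seminormality fails exactly at CUSPS: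
elements `p ∉ N_k` with `p², p³ ∈ N_k`.  The kernel-checked content below is the elementary half of this
remark, which is all a refuter needs:

* `eq_of_pow_eq_of_pow_succ_eq` — in a field, `a^m = b^m` and `a^(m+1) = b^(m+1)` (`m ≥ 1`) force `a = b`;
* `determined_of_pow_determined` — hence if `p^m` and `p^(m+1)` are determined by `HomIndist n k`, so is
  `p` (the determined polynomials are closed under this root extraction; they are also a subalgebra:
  `determined_one/add/mul/smul`);
* `determined_of_sq_cube_mem_narrowSpan` — in particular `p², p³` NARROW of width `w < k` ⇒ `p` DETERMINED
  by `HomIndist n k` (narrow ⇒ determined is `NarrowDetermined.eval_eq_of_mem_narrowSpan`);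
* `mem_narrowSpan_of_Q1_of_sq_cube` / `not_Q1_of_cusp` — **THE CUSP TEST**: under (Q1) at `(n, k)` (stated
  verbatim as the hypothesis `hQ1` of `NarrowDetermined.narrowExpansionVP_of_homDeterminedVP_of_Q1`) the
  narrow span is `(2,3)`-closed; contrapositively ONE polynomial `p` with `p², p³` in the span of the
  `hom_{F,n}` (`tw F ≤ w`, `w < k`) but `p` outside the span of the `hom_{F,n}` (`tw F ≤ k`) REFUTES (Q1) at
  `(n, k)` — three finite linear-algebra certificates over the finitely many patterns with `deg p`,
  `2 deg p`, `3 deg p` edges, no quantifier over points of `ℂ^{n×n}`.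

Calibration (evidence `Q1-PROBE.md` on the item, this session): at `(n, k) = (3, 2)` the forest span is ALL
of `S` through degree `7` and at `(4, 2)` the determined polynomials cut out by Latin-square / block-flip
colour-refinement twins coincide with the forest span through degree `7` — no cusp in range; (Q1) open.
Honest label: bookkeeping + a refutation FORMAT; no stub closed; VP ≠ VNP not moved.
[cite: DwivediPagoSeppelt2026, Def. 3.2, Cor. 3.3]
-/

-- `Summit.ValiantsHypothesis.ValiantsHypothesis.…` is the tree's mandated namespace (Sub = Summit).
set_option linter.dupNamespace false

noncomputable section

namespace Summit.ValiantsHypothesis.ValiantsHypothesis.Theorems.MonotoneRestorationQPLinearWidth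

namespace CuspTest

open Literature.Computability.AlgebraicComplexity MvPolynomial

variable {n : ℕ}

/-! ### Root extraction in a field -/

/-- In a field, `a ^ m = b ^ m` and `a ^ (m+1) = b ^ (m+1)` with `m ≥ 1` force `a = b`. [folklore] -/
theorem eq_of_pow_eq_of_pow_succ_eq {K : Type*} [Field K] {a b : K} {m : ℕ} (hm : 0 < m)
    (h₁ : a ^ m = b ^ m) (h₂ : a ^ (m + 1) = b ^ (m + 1)) : a = b := by
  by_cases hb : b ^ m = 0
  · have hb0 : b = 0 := pow_eq_zero_iff (n := m) (by omega) |>.mp hb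
    have ha0 : a = 0 := pow_eq_zero_iff (n := m) (by omega) |>.mp (h₁.trans hb)
    rw [ha0, hb0]
  · have h : a * b ^ m = b * b ^ m := by
      calc a * b ^ m = a * a ^ m := by rw [h₁]
        _ = a ^ (m + 1) := by ring
        _ = b ^ (m + 1) := h₂
        _ = b * b ^ m := by ring
    exact mul_right_cancel₀ hb h

/-- The case `m = 1, 2`: equal squares and equal cubes force equality. [folklore] -/
theorem eq_of_sq_eq_of_cube_eq {K : Type*} [Field K] {a b : K} (h₂ : a ^ 2 = b ^ 2)
    (h₃ : a ^ 3 = b ^ 3) : a = b :=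
  eq_of_pow_eq_of_pow_succ_eq (m := 2) (by norm_num) h₂ h₃

/-! ### Determined polynomials: a subalgebra closed under root extraction -/

/-- Constants are determined by `HomIndist n k` (any `k`). [folklore] -/
theorem determined_C (k : ℕ) (c : ℂ) :
    ∀ A B : Fin n × Fin n → ℂ, HomIndist n k A B → eval A (C c) = eval B (C c) := by
  intro A B _
  simp

/-- Determined polynomials are closed under addition. [folklore] -/
theorem determined_add (k : ℕ) {p q : MvPolynomial (Fin n × Fin n) ℂ}
    (hp : ∀ A B : Fin n × Fin n → ℂ, HomIndist n k A B → eval A p = eval B p)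
    (hq : ∀ A B : Fin n × Fin n → ℂ, HomIndist n k A B → eval A q = eval B q) :
    ∀ A B : Fin n × Fin n → ℂ, HomIndist n k A B → eval A (p + q) = eval B (p + q) := by
  intro A B h
  simp [hp A B h, hq A B h]

/-- Determined polynomials are closed under multiplication. [folklore] -/
theorem determined_mul (k : ℕ) {p q : MvPolynomial (Fin n × Fin n) ℂ}
    (hp : ∀ A B : Fin n × Fin n → ℂ, HomIndist n k A B → eval A p = eval B p)
    (hq : ∀ A B : Fin n × Fin n → ℂ, HomIndist n k A B → eval A q = eval B q) :
    ∀ A B : Fin n × Fin n → ℂ, HomIndist n k A B → eval A (p * q) = eval B (p * q) := by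
  intro A B h
  simp [hp A B h, hq A B h]

/-- Determined polynomials are closed under scalars. [folklore] -/
theorem determined_smul (k : ℕ) (c : ℂ) {p : MvPolynomial (Fin n × Fin n) ℂ}
    (hp : ∀ A B : Fin n × Fin n → ℂ, HomIndist n k A B → eval A p = eval B p) :
    ∀ A B : Fin n × Fin n → ℂ, HomIndist n k A B → eval A (c • p) = eval B (c • p) := by
  intro A B h
  simp [smul_eval, hp A B h]

/-- Determined polynomials are closed under powers. [folklore] -/
theorem determined_pow (k m : ℕ) {p : MvPolynomial (Fin n × Fin n) ℂ}
    (hp : ∀ A B : Fin n × Fin n → ℂ, HomIndist n k A B → eval A p = eval B p) :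
    ∀ A B : Fin n × Fin n → ℂ, HomIndist n k A B → eval A (p ^ m) = eval B (p ^ m) := by
  intro A B h
  simp [hp A B h]

/-- **Root extraction.**  If `p ^ m` and `p ^ (m+1)` (`m ≥ 1`) are determined by `HomIndist n k`, so is
`p`: the determined polynomials are `(m, m+1)`-closed inside the polynomial ring — the elementary shadow
of "determined = seminormalisation of narrow". [folklore] -/
theorem determined_of_pow_determined (k : ℕ) {m : ℕ} (hm : 0 < m) {p : MvPolynomial (Fin n × Fin n) ℂ}
    (h₁ : ∀ A B : Fin n × Fin n → ℂ, HomIndist n k A B → eval A (p ^ m) = eval B (p ^ m))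
    (h₂ : ∀ A B : Fin n × Fin n → ℂ, HomIndist n k A B → eval A (p ^ (m + 1)) = eval B (p ^ (m + 1))) :
    ∀ A B : Fin n × Fin n → ℂ, HomIndist n k A B → eval A p = eval B p := by
  intro A B h
  have e₁ := h₁ A B h
  have e₂ := h₂ A B h
  simp only [map_pow] at e₁ e₂
  exact eq_of_pow_eq_of_pow_succ_eq hm e₁ e₂

/-- Squares and cubes: `p², p³` determined ⇒ `p` determined. [folklore] -/
theorem determined_of_sq_cube_determined (k : ℕ) {p : MvPolynomial (Fin n × Fin n) ℂ}
    (h₂ : ∀ A B : Fin n × Fin n → ℂ, HomIndist n k A B → eval A (p ^ 2) = eval B (p ^ 2))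
    (h₃ : ∀ A B : Fin n × Fin n → ℂ, HomIndist n k A B → eval A (p ^ 3) = eval B (p ^ 3)) :
    ∀ A B : Fin n × Fin n → ℂ, HomIndist n k A B → eval A p = eval B p :=
  determined_of_pow_determined k (m := 2) (by norm_num) h₂ h₃

/-! ### Narrow powers ⇒ determined root -/

/-- **Narrow ⇒ determined**, in the `HomIndist` vocabulary of `…LinearWidthDefs.lean`: a polynomial in the
span of the `hom_{F,n}` with `tw F ≤ w` is determined by `HomIndist n k` for every `k > w`
(`NarrowDetermined.eval_eq_of_mem_narrowSpan`, restated). [cite: DwivediPagoSeppelt2026, Def. 3.2] -/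
theorem determined_of_mem_narrowSpan {w k : ℕ} (hwk : w < k) {p : MvPolynomial (Fin n × Fin n) ℂ}
    (hp : p ∈ Submodule.span ℂ
      {q : MvPolynomial (Fin n × Fin n) ℂ | ∃ (a b : ℕ) (E : Multiset (Fin a × Fin b)),
        Literature.Combinatorics.SimpleGraph.treewidth
            (SimpleGraph.fromRel fun u v : Fin a ⊕ Fin b =>
              ∃ e ∈ E, u = Sum.inl e.1 ∧ v = Sum.inr e.2) ≤ w ∧
          q = homPoly E n ℂ}) :
    ∀ A B : Fin n × Fin n → ℂ, HomIndist n k A B → eval A p = eval B p :=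
  fun A B h => NarrowDetermined.eval_eq_of_mem_narrowSpan hwk hp A B h

/-- **`p², p³` narrow of width `w < k` ⇒ `p` determined by `HomIndist n k`.** [folklore] -/
theorem determined_of_sq_cube_mem_narrowSpan {w k : ℕ} (hwk : w < k)
    {p : MvPolynomial (Fin n × Fin n) ℂ}
    (h₂ : p ^ 2 ∈ Submodule.span ℂ
      {q : MvPolynomial (Fin n × Fin n) ℂ | ∃ (a b : ℕ) (E : Multiset (Fin a × Fin b)),
        Literature.Combinatorics.SimpleGraph.treewidth
            (SimpleGraph.fromRel fun u v : Fin a ⊕ Fin b =>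
              ∃ e ∈ E, u = Sum.inl e.1 ∧ v = Sum.inr e.2) ≤ w ∧
          q = homPoly E n ℂ})
    (h₃ : p ^ 3 ∈ Submodule.span ℂ
      {q : MvPolynomial (Fin n × Fin n) ℂ | ∃ (a b : ℕ) (E : Multiset (Fin a × Fin b)),
        Literature.Combinatorics.SimpleGraph.treewidth
            (SimpleGraph.fromRel fun u v : Fin a ⊕ Fin b =>
              ∃ e ∈ E, u = Sum.inl e.1 ∧ v = Sum.inr e.2) ≤ w ∧
          q = homPoly E n ℂ}) :
    ∀ A B : Fin n × Fin n → ℂ, HomIndist n k A B → eval A p = eval B p :=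
  determined_of_sq_cube_determined k (determined_of_mem_narrowSpan hwk h₂)
    (determined_of_mem_narrowSpan hwk h₃)

/-- More generally `p^m, p^(m+1)` narrow of width `w < k` (`m ≥ 1`) ⇒ `p` determined by `HomIndist n k`.
[folklore] -/
theorem determined_of_pow_mem_narrowSpan {w k m : ℕ} (hwk : w < k) (hm : 0 < m)
    {p : MvPolynomial (Fin n × Fin n) ℂ}
    (h₁ : p ^ m ∈ Submodule.span ℂ
      {q : MvPolynomial (Fin n × Fin n) ℂ | ∃ (a b : ℕ) (E : Multiset (Fin a × Fin b)),
        Literature.Combinatorics.SimpleGraph.treewidth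
            (SimpleGraph.fromRel fun u v : Fin a ⊕ Fin b =>
              ∃ e ∈ E, u = Sum.inl e.1 ∧ v = Sum.inr e.2) ≤ w ∧
          q = homPoly E n ℂ})
    (h₂ : p ^ (m + 1) ∈ Submodule.span ℂ
      {q : MvPolynomial (Fin n × Fin n) ℂ | ∃ (a b : ℕ) (E : Multiset (Fin a × Fin b)),
        Literature.Combinatorics.SimpleGraph.treewidth
            (SimpleGraph.fromRel fun u v : Fin a ⊕ Fin b =>
              ∃ e ∈ E, u = Sum.inl e.1 ∧ v = Sum.inr e.2) ≤ w ∧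
          q = homPoly E n ℂ}) :
    ∀ A B : Fin n × Fin n → ℂ, HomIndist n k A B → eval A p = eval B p :=
  determined_of_pow_determined k hm (determined_of_mem_narrowSpan hwk h₁)
    (determined_of_mem_narrowSpan hwk h₂)

/-! ### The cusp test for (Q1) -/

/-- **(Q1) ⇒ the narrow span is `(2,3)`-closed.**  Under (Q1) at `(n, k)` — verbatim the hypothesis `hQ1`
of `NarrowDetermined.narrowExpansionVP_of_homDeterminedVP_of_Q1` specialised to this `n, k` — every `p`
whose square and cube are narrow of some width `w < k` is itself narrow of width `k`. [folklore] -/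
theorem mem_narrowSpan_of_Q1_of_sq_cube {k : ℕ}
    (hQ1 : ∀ p : MvPolynomial (Fin n × Fin n) ℂ,
      (∀ A B : Fin n × Fin n → ℂ,
        (∀ (a b : ℕ) (E : Multiset (Fin a × Fin b)),
          Literature.Combinatorics.SimpleGraph.treewidth
            (SimpleGraph.fromRel fun u v : Fin a ⊕ Fin b =>
              ∃ p ∈ E, u = Sum.inl p.1 ∧ v = Sum.inr p.2) < k →
          eval A (homPoly E n ℂ) = eval B (homPoly E n ℂ)) →
        eval A p = eval B p) →
      p ∈ Submodule.span ℂ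
        {q : MvPolynomial (Fin n × Fin n) ℂ | ∃ (a b : ℕ) (E : Multiset (Fin a × Fin b)),
          Literature.Combinatorics.SimpleGraph.treewidth
              (SimpleGraph.fromRel fun u v : Fin a ⊕ Fin b =>
                ∃ e ∈ E, u = Sum.inl e.1 ∧ v = Sum.inr e.2) ≤ k ∧
            q = homPoly E n ℂ})
    {w : ℕ} (hwk : w < k) {p : MvPolynomial (Fin n × Fin n) ℂ}
    (h₂ : p ^ 2 ∈ Submodule.span ℂ
      {q : MvPolynomial (Fin n × Fin n) ℂ | ∃ (a b : ℕ) (E : Multiset (Fin a × Fin b)),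
        Literature.Combinatorics.SimpleGraph.treewidth
            (SimpleGraph.fromRel fun u v : Fin a ⊕ Fin b =>
              ∃ e ∈ E, u = Sum.inl e.1 ∧ v = Sum.inr e.2) ≤ w ∧
          q = homPoly E n ℂ})
    (h₃ : p ^ 3 ∈ Submodule.span ℂ
      {q : MvPolynomial (Fin n × Fin n) ℂ | ∃ (a b : ℕ) (E : Multiset (Fin a × Fin b)),
        Literature.Combinatorics.SimpleGraph.treewidth
            (SimpleGraph.fromRel fun u v : Fin a ⊕ Fin b =>
              ∃ e ∈ E, u = Sum.inl e.1 ∧ v = Sum.inr e.2) ≤ w ∧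
          q = homPoly E n ℂ}) :
    p ∈ Submodule.span ℂ
        {q : MvPolynomial (Fin n × Fin n) ℂ | ∃ (a b : ℕ) (E : Multiset (Fin a × Fin b)),
          Literature.Combinatorics.SimpleGraph.treewidth
              (SimpleGraph.fromRel fun u v : Fin a ⊕ Fin b =>
                ∃ e ∈ E, u = Sum.inl e.1 ∧ v = Sum.inr e.2) ≤ k ∧
            q = homPoly E n ℂ} :=
  hQ1 p fun A B h => determined_of_sq_cube_mem_narrowSpan hwk h₂ h₃ A B h

/-- **THE CUSP TEST.**  One polynomial `p` at level `n` with `p²` and `p³` in the span of the `hom_{F,n}`,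
`tw F ≤ w` (`w < k`), but `p` itself NOT in the span of the `hom_{F,n}`, `tw F ≤ k`, refutes (Q1) at
`(n, k)` (verbatim the hypothesis `hQ1` of `NarrowDetermined.narrowExpansionVP_of_homDeterminedVP_of_Q1`
at this `n, k`).  All three certificates are finite linear algebra over the patterns with `deg p`,
`2 deg p`, `3 deg p` edges. [folklore] -/
theorem not_Q1_of_cusp {k w : ℕ} (hwk : w < k) (p : MvPolynomial (Fin n × Fin n) ℂ)
    (h₂ : p ^ 2 ∈ Submodule.span ℂ
      {q : MvPolynomial (Fin n × Fin n) ℂ | ∃ (a b : ℕ) (E : Multiset (Fin a × Fin b)),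
        Literature.Combinatorics.SimpleGraph.treewidth
            (SimpleGraph.fromRel fun u v : Fin a ⊕ Fin b =>
              ∃ e ∈ E, u = Sum.inl e.1 ∧ v = Sum.inr e.2) ≤ w ∧
          q = homPoly E n ℂ})
    (h₃ : p ^ 3 ∈ Submodule.span ℂ
      {q : MvPolynomial (Fin n × Fin n) ℂ | ∃ (a b : ℕ) (E : Multiset (Fin a × Fin b)),
        Literature.Combinatorics.SimpleGraph.treewidth
            (SimpleGraph.fromRel fun u v : Fin a ⊕ Fin b =>
              ∃ e ∈ E, u = Sum.inl e.1 ∧ v = Sum.inr e.2) ≤ w ∧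
          q = homPoly E n ℂ})
    (hp : p ∉ Submodule.span ℂ
        {q : MvPolynomial (Fin n × Fin n) ℂ | ∃ (a b : ℕ) (E : Multiset (Fin a × Fin b)),
          Literature.Combinatorics.SimpleGraph.treewidth
              (SimpleGraph.fromRel fun u v : Fin a ⊕ Fin b =>
                ∃ e ∈ E, u = Sum.inl e.1 ∧ v = Sum.inr e.2) ≤ k ∧
            q = homPoly E n ℂ}) :
    ¬ ∀ q : MvPolynomial (Fin n × Fin n) ℂ,
      (∀ A B : Fin n × Fin n → ℂ,
        (∀ (a b : ℕ) (E : Multiset (Fin a × Fin b)),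
          Literature.Combinatorics.SimpleGraph.treewidth
            (SimpleGraph.fromRel fun u v : Fin a ⊕ Fin b =>
              ∃ p ∈ E, u = Sum.inl p.1 ∧ v = Sum.inr p.2) < k →
          eval A (homPoly E n ℂ) = eval B (homPoly E n ℂ)) →
        eval A q = eval B q) →
      q ∈ Submodule.span ℂ
        {q : MvPolynomial (Fin n × Fin n) ℂ | ∃ (a b : ℕ) (E : Multiset (Fin a × Fin b)),
          Literature.Combinatorics.SimpleGraph.treewidth
              (SimpleGraph.fromRel fun u v : Fin a ⊕ Fin b =>
                ∃ e ∈ E, u = Sum.inl e.1 ∧ v = Sum.inr e.2) ≤ k ∧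
            q = homPoly E n ℂ} :=
  fun hQ1 => hp (mem_narrowSpan_of_Q1_of_sq_cube hQ1 hwk h₂ h₃)

/-- **The global form.**  A cusp at ONE level refutes the all-levels hypothesis `hQ1` of
`NarrowDetermined.narrowExpansionVP_of_homDeterminedVP_of_Q1` (verbatim). [folklore] -/
theorem not_Q1_allLevels_of_cusp {n k w : ℕ} (hwk : w < k) (p : MvPolynomial (Fin n × Fin n) ℂ)
    (h₂ : p ^ 2 ∈ Submodule.span ℂ
      {q : MvPolynomial (Fin n × Fin n) ℂ | ∃ (a b : ℕ) (E : Multiset (Fin a × Fin b)),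
        Literature.Combinatorics.SimpleGraph.treewidth
            (SimpleGraph.fromRel fun u v : Fin a ⊕ Fin b =>
              ∃ e ∈ E, u = Sum.inl e.1 ∧ v = Sum.inr e.2) ≤ w ∧
          q = homPoly E n ℂ})
    (h₃ : p ^ 3 ∈ Submodule.span ℂ
      {q : MvPolynomial (Fin n × Fin n) ℂ | ∃ (a b : ℕ) (E : Multiset (Fin a × Fin b)),
        Literature.Combinatorics.SimpleGraph.treewidth
            (SimpleGraph.fromRel fun u v : Fin a ⊕ Fin b =>
              ∃ e ∈ E, u = Sum.inl e.1 ∧ v = Sum.inr e.2) ≤ w ∧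
          q = homPoly E n ℂ})
    (hp : p ∉ Submodule.span ℂ
        {q : MvPolynomial (Fin n × Fin n) ℂ | ∃ (a b : ℕ) (E : Multiset (Fin a × Fin b)),
          Literature.Combinatorics.SimpleGraph.treewidth
              (SimpleGraph.fromRel fun u v : Fin a ⊕ Fin b =>
                ∃ e ∈ E, u = Sum.inl e.1 ∧ v = Sum.inr e.2) ≤ k ∧
            q = homPoly E n ℂ}) :
    ¬ ∀ (n k : ℕ) (q : MvPolynomial (Fin n × Fin n) ℂ),
      (∀ A B : Fin n × Fin n → ℂ,
        (∀ (a b : ℕ) (E : Multiset (Fin a × Fin b)),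
          Literature.Combinatorics.SimpleGraph.treewidth
            (SimpleGraph.fromRel fun u v : Fin a ⊕ Fin b =>
              ∃ p ∈ E, u = Sum.inl p.1 ∧ v = Sum.inr p.2) < k →
          eval A (homPoly E n ℂ) = eval B (homPoly E n ℂ)) →
        eval A q = eval B q) →
      q ∈ Submodule.span ℂ
        {q : MvPolynomial (Fin n × Fin n) ℂ | ∃ (a b : ℕ) (E : Multiset (Fin a × Fin b)),
          Literature.Combinatorics.SimpleGraph.treewidth
              (SimpleGraph.fromRel fun u v : Fin a ⊕ Fin b =>
                ∃ e ∈ E, u = Sum.inl e.1 ∧ v = Sum.inr e.2) ≤ k ∧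
            q = homPoly E n ℂ} :=
  fun hQ1 => not_Q1_of_cusp hwk p h₂ h₃ hp (hQ1 n k)

end CuspTest

end Summit.ValiantsHypothesis.ValiantsHypothesis.Theorems.MonotoneRestorationQPLinearWidth

end
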